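import Literature.NumberTheory.LocalFields.NodeValuesUnitBinomialTwist
import Literature.NumberTheory.EllipticCurves.DeShalit1987.KatzMeasureMonomialLinesPAdic
import Literature.NumberTheory.EllipticCurves.Rubin1991.TwoVariableCMLines
import Mathlib.Tactic
import HarnessLib

set_option autoImplicit false

/-!
# Transport of `𝒪_{ℂ_p}⟦T⟧` along a geometric progression of nodes: two integral series of unit
# content whose values at `uᵗ − 1` are proportional by `c·dᵗ` differ by a UNIT BINOMIAL TWIST
# `F' = c₀·(1+T)^z·F`, `z ∈ ℤ_p`, `c₀ ∈ 𝒪_{ℂ_p}ˣ`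

Topic `NumberTheory/EllipticCurves` (receptacle `𝒪_{ℂ_p}⟦T⟧`, values `IntSeries.HasValueAt`; sharpens
`IntSeriesValueNormRigidity.norm_eq_one_of_values_proportional` — which only gives `‖d‖ = 1` — to the
exact statement). The analysis and the `p`-adic number theory live in `NumberTheory/LocalFields/`
(`BinomialTwistOfNodeValues`: `(1+X)(FF'′ − F'F′) = e·FF'` by strict differentiability along
`t ↦ t + p^k` and Strassmann; `BinomialSeriesDifferentialEquation`: `F' = Q·F`, `(1+X)Q′ = eQ`;
`BinomialTwistExponentPadicIntegral` + `BinomialCoefficientsPadicIntegral`: `e ∈ ℤ_p`, i.e. every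
`C(e,n)` is `p`-integral, the converse of Gouvêa's Lemma 5.9.1; `NodeValuesUnitBinomialTwist`:
`‖Q(0)‖ = 1`); this file is the bridge to the tree's `IntSeries` currency (`binomPow z = (1+T)^z`,
`onePlusPow z x = (1+x)^z`).

WHY (cell `bsd`, K6 frame currency; crux `CycTangentCM.CycTangentBound`, stmt-BirchSwinnertonDyer-22628,
negative road `H` and stub `stub_selfDual`, both quantified over ALL frames). Two typed Katz–de Shalit
frames of the same datum with different period triples prescribe, on one `ℤ_p`-line, node values
`x'_t = C^{a+bt}·x_t`; by this file the two one-variable branches differ by a unit of `𝒪_{ℂ_p}⟦T⟧` of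
evaluation type `c₀·r ↦ r(γ)^z` — so `λ̄`, `μ`, unit content, the Weierstrass degree and every
"unit coefficient in degree `n`" statement are invariants of the datum, not of the periods, and a
pointwise functional equation for one frame transports to every frame (with `g ↦ g·γ^z`).

* **`exists_unit_binomPow_of_values_proportional`** — `F, F' ∈ 𝒪_{ℂ_p}⟦T⟧` each with a unit
  coefficient, `u` a one-unit that is not a root of unity, `c, d ≠ 0`, values `x_t = F(uᵗ − 1)`,
  `x'_t = F'(uᵗ − 1)` with `x'_t = c·dᵗ·x_t` for all `t` and one `x_{t₀} ≠ 0` ⟹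
  `F' = C c₀ · binomPow z · F` for some `z ∈ ℤ_p` and unit `c₀ ∈ 𝒪_{ℂ_p}ˣ`.
* `hasValueAt_of_unit_binomPow` — hence `F'(y) = c₀·(1+y)^z·F(y)` at every point of the open disc,
  and `exists_unit_onePlusPow_eq_of_values_proportional` — `c·dᵗ = c₀·(uᵗ)^z` at every node where
  `x_t ≠ 0` (all but finitely many).

Not here: `d = u^z` itself (needs `(uv)^z = u^z v^z` for `onePlusPow`, not yet in the tree).
THEOREMS ONLY (no definition, no named fact, no `sorry`).

## References

* F. Q. Gouvêa, *p-adic Numbers*, Universitext, Springer 1993, §5.9 Lemma 5.9.1, Problem 194.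
  [Gouvea1993PadicNumbers]
* A. M. Robert, *A Course in p-adic Analysis*, GTM 198, Springer 2000, Ch. V §2.4 Theorem 1,
  Ch. VI §2.1 (Strassman). [Robert2000PadicAnalysis]
* N. Koblitz, *p-adic Numbers, p-adic Analysis, and Zeta-Functions*, GTM 58, Ch. IV §1 (the binomial
  series `(1+X)^a`, `a ∈ ℤ_p`). [Koblitz1984]
-/

noncomputable section

open scoped Classical
open Filter Topology PowerSeries Finset
open Literature.NumberTheory.LocalFields

namespace Literature.NumberTheory.EllipticCurves.IntSeries

variable {p : ℕ} [Fact p.Prime]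

/-! ### §1. Reading `𝒪_{ℂ_p}⟦T⟧` in `ℂ_p⟦T⟧` -/

/-- The coefficient embedding `𝒪_{ℂ_p} ↪ ℂ_p` on power series: coefficients.
[cite: Koblitz1984, Ch. IV §1] -/
theorem coeff_map_subtype (F : PowerSeries (PadicComplexInt p)) (n : ℕ) :
    coeff n (F.map (PadicComplexInt p).toSubring.subtype) = ((coeff n F : PadicComplexInt p) : ℂ_[p]) :=
  coeff_map _ _ _

/-- `F ↦ F.map (𝒪_{ℂ_p} ↪ ℂ_p)` is injective. [cite: Koblitz1984, Ch. IV §1] -/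
theorem map_subtype_injective :
    Function.Injective fun F : PowerSeries (PadicComplexInt p) ↦
      F.map (PadicComplexInt p).toSubring.subtype :=
  PowerSeries.map_injective _ Subtype.coe_injective

/-- An integral series read in `ℂ_p⟦T⟧` has coefficients of norm `≤ 1`. [cite: Koblitz1984, Ch. IV §1] -/
theorem norm_coeff_map_subtype_le_one (F : PowerSeries (PadicComplexInt p)) (n : ℕ) :
    ‖coeff n (F.map (PadicComplexInt p).toSubring.subtype)‖ ≤ 1 := by
  rw [coeff_map_subtype]; exact norm_coe_padicComplexInt_le_one _

/-- A unit coefficient read in `ℂ_p` has norm `1`. [cite: Koblitz1984, Ch. IV §1] -/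
theorem norm_coeff_map_subtype_eq_one {F : PowerSeries (PadicComplexInt p)} {n : ℕ}
    (h : IsUnit (coeff n F)) : ‖coeff n (F.map (PadicComplexInt p).toSubring.subtype)‖ = 1 := by
  rw [coeff_map_subtype]; exact isUnit_padicComplexInt_iff.mp h

/-- A value `HasValueAt F y v` (`‖y‖ < 1`) is the `tsum` of the series read in `ℂ_p⟦T⟧`.
[cite: Koblitz1984, Ch. IV §1] -/
theorem tsum_coeff_map_subtype_eq_of_hasValueAt {F : PowerSeries (PadicComplexInt p)} {y v : ℂ_[p]}
    (h : IntSeries.HasValueAt F y v) :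
    ∑' n, coeff n (F.map (PadicComplexInt p).toSubring.subtype) * y ^ n = v := by
  simp_rw [coeff_map_subtype]; exact h.tsum_eq

/-- A series of `ℂ_p⟦T⟧` with coefficients of norm `≤ 1` is (the image of) an integral series.
[cite: Koblitz1984, Ch. IV §1] -/
theorem exists_map_subtype_eq_of_norm_coeff_le_one {Q : ℂ_[p]⟦X⟧} (hQ : ∀ n, ‖coeff n Q‖ ≤ 1) :
    ∃ Q₀ : PowerSeries (PadicComplexInt p), Q₀.map (PadicComplexInt p).toSubring.subtype = Q := by
  refine ⟨PowerSeries.mk fun n ↦ ⟨coeff n Q, mem_padicComplexInt_iff.mpr (hQ n)⟩, ?_⟩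
  ext n
  rw [coeff_map, coeff_mk]
  rfl

/-! ### §2. `binomPow z` read in `ℂ_p⟦T⟧` solves `(1+X)B′ = zB` -/

/-- `n!·C(z,n) = z(z−1)⋯(z−n+1)` in `ℤ_p`. [cite: Gouvea1993PadicNumbers, §5.9 Lemma 5.9.1] -/
theorem factorial_mul_choose_eq_prod (z : ℤ_[p]) (n : ℕ) :
    (n.factorial : ℤ_[p]) * Ring.choose z n = ∏ j ∈ range n, (z - (j : ℤ_[p])) := by
  rw [← descPochhammer_eval_eq_prod_range, ← nsmul_eq_mul,
    ← Ring.descPochhammer_eq_factorial_smul_choose, ← Polynomial.eval₂_smulOneHom_eq_smeval,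
    ← descPochhammer_map (Int.castRingHom ℤ_[p]), Polynomial.eval_map,
    Subsingleton.elim (Int.castRingHom ℤ_[p]) RingHom.smulOneHom]

/-- **`(1+T)^z` solves the binomial differential equation**: for `B = binomPow z` read in `ℂ_p⟦T⟧`,
`(1 + X)·B′ = z·B`. [cite: Gouvea1993PadicNumbers, §5.9 (the binomial series `B(α,X)`)] -/
theorem ode_binomPow_map (z : ℤ_[p]) :
    (1 + X) * derivative ℂ_[p] ((binomPow z).map (PadicComplexInt p).toSubring.subtype) =
      C (((z : ℚ_[p]) : ℂ_[p])) * (binomPow z).map (PadicComplexInt p).toSubring.subtype := by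
  -- `binomPow z` read in `ℂ_p⟦T⟧` IS the normalised solution `Σ z(z−1)⋯(z−n+1)/n!·Xⁿ`
  have hB : (binomPow z).map (PadicComplexInt p).toSubring.subtype =
      PowerSeries.mk fun n : ℕ ↦ (∏ j ∈ range n, (((z : ℚ_[p]) : ℂ_[p]) - (j : ℂ_[p]))) / (n.factorial : ℂ_[p]) := by
    ext n
    rw [coeff_map_subtype, coeff_binomPow, coe_padicIntToComplexInt, coeff_mk,
      eq_div_iff (by exact_mod_cast Nat.factorial_ne_zero n)]
    have h := congrArg ((algebraMap ℚ_[p] ℂ_[p]).comp PadicInt.Coe.ringHom)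
      (factorial_mul_choose_eq_prod z n)
    rw [map_mul, map_natCast, map_prod] at h
    simp only [map_sub, map_natCast, RingHom.coe_comp, Function.comp_apply] at h
    rw [mul_comm]
    exact h
  rw [hB]
  exact ode_binomialSeries_mk _

/-! ### §3. The transport theorem in the `IntSeries` currency -/

/-- **Proportional node values force a UNIT BINOMIAL TWIST.** Let `F, F' ∈ 𝒪_{ℂ_p}⟦T⟧` each have a
unit coefficient, `u ∈ ℂ_p` a one-unit which is not a root of unity, `c, d ≠ 0`, and let
`x_t = F(uᵗ − 1)`, `x'_t = F'(uᵗ − 1)` satisfy `x'_t = c·dᵗ·x_t` for all `t ∈ ℕ` with one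
`x_{t₀} ≠ 0`. Then `F' = c₀·(1+T)^z·F` for some `z ∈ ℤ_p` and some unit `c₀` of `𝒪_{ℂ_p}`.
[cite: Gouvea1993PadicNumbers, §5.9 Lemma 5.9.1 (converse) and Problem 194]
[cite: Robert2000PadicAnalysis, Ch. V §2.4 Theorem 1; Ch. VI §2.1 Theorem (Strassman)] -/
theorem exists_unit_binomPow_of_values_proportional {F F' : PowerSeries (PadicComplexInt p)}
    {u c d : ℂ_[p]} {x x' : ℕ → ℂ_[p]} (hu : ‖u - 1‖ < 1) (hroot : ∀ n : ℕ, 0 < n → u ^ n ≠ 1)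
    (hc : c ≠ 0) (hd : d ≠ 0) (hx : ∀ t : ℕ, IntSeries.HasValueAt F (u ^ t - 1) (x t))
    (hx' : ∀ t : ℕ, IntSeries.HasValueAt F' (u ^ t - 1) (x' t))
    (hrel : ∀ t : ℕ, x' t = c * d ^ t * x t) {t₀ : ℕ} (h0 : x t₀ ≠ 0)
    (hFu : ∃ n, IsUnit (coeff n F)) (hF'u : ∃ n, IsUnit (coeff n F')) :
    ∃ (z : ℤ_[p]) (c₀ : (PadicComplexInt p)ˣ),
      F' = C ((c₀ : PadicComplexInt p)) * binomPow z * F := by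
  set ι := (PadicComplexInt p).toSubring.subtype with hι
  set f := F.map ι with hf
  set g := F'.map ι with hg
  have hfi : ∀ n, ‖coeff n f‖ ≤ 1 := norm_coeff_map_subtype_le_one F
  have hgi : ∀ n, ‖coeff n g‖ ≤ 1 := norm_coeff_map_subtype_le_one F'
  have hfu : ∃ n, ‖coeff n f‖ = 1 := hFu.imp fun n hn ↦ norm_coeff_map_subtype_eq_one hn
  have hgu : ∃ n, ‖coeff n g‖ = 1 := hF'u.imp fun n hn ↦ norm_coeff_map_subtype_eq_one hn
  have hrel' : ∀ t : ℕ, ∑' n, coeff n g * (u ^ t - 1) ^ n = c * d ^ t * ∑' n, coeff n f * (u ^ t - 1) ^ n := by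
    intro t
    rw [tsum_coeff_map_subtype_eq_of_hasValueAt (hx' t), tsum_coeff_map_subtype_eq_of_hasValueAt (hx t)]
    exact hrel t
  have h0' : ∑' n, coeff n f * (u ^ t₀ - 1) ^ n ≠ 0 := by
    rw [tsum_coeff_map_subtype_eq_of_hasValueAt (hx t₀)]; exact h0
  obtain ⟨z, Q, hgQ, hQ⟩ :=
    exists_padicInt_binomial_twist_of_node_values (p := p) hfi hgi hfu hgu hu hroot hc hd hrel' h0'
  have hz : ((algebraMap ℚ_[p] ℂ_[p]) (z : ℚ_[p])) = ((z : ℚ_[p]) : ℂ_[p]) := rfl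
  -- `Q` is integral with unit constant term
  have hQi : ∀ n, ‖coeff n Q‖ ≤ 1 := norm_coeff_le_one_of_binomial_twist (p := p) hfi hgi hfu hgu hgQ hQ
  have hQ0 : ‖constantCoeff Q‖ = 1 := norm_constantCoeff_eq_one_of_binomial_twist (p := p) hfi hgi hfu hgu hgQ hQ
  obtain ⟨Q₀, hQ₀⟩ := exists_map_subtype_eq_of_norm_coeff_le_one hQi
  have hQ₀0 : IsUnit (constantCoeff Q₀) := by
    rw [isUnit_padicComplexInt_iff, ← coeff_zero_eq_constantCoeff_apply, ← coeff_map_subtype, hQ₀,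
      coeff_zero_eq_constantCoeff_apply]
    exact hQ0
  obtain ⟨c₀, hc₀⟩ := hQ₀0
  refine ⟨z, c₀, map_subtype_injective (p := p) ?_⟩
  -- `Q = Q(0)·(1+T)^z` by uniqueness of solutions of `(1+X)Q′ = zQ`
  have hB := ode_binomPow_map (p := p) z
  rw [← hz] at hB
  have huniq := constantCoeff_smul_eq_of_ode hQ hB
  rw [← coeff_zero_eq_constantCoeff_apply (φ := (binomPow z).map _), coeff_map_subtype,
    coeff_zero_eq_constantCoeff_apply, constantCoeff_binomPow, OneMemClass.coe_one, one_smul] at huniq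
  -- `huniq : Q(0) • (binomPow z).map = Q`
  have hQ0' : constantCoeff Q = ι c₀ := by
    rw [← coeff_zero_eq_constantCoeff_apply, ← hQ₀, coeff_map, coeff_zero_eq_constantCoeff_apply, ← hc₀]
  simp only [map_mul, map_C]
  change F'.map ι = C (ι c₀) * (binomPow z).map ι * F.map ι
  calc F'.map ι = g := rfl
    _ = Q * f := hgQ
    _ = (constantCoeff Q • (binomPow z).map ι) * f := by rw [huniq]
    _ = C (ι c₀) * (binomPow z).map ι * F.map ι := by rw [hQ0', smul_eq_C_mul]

/-- **Values transport by the unit binomial twist**: if `F' = c₀·(1+T)^z·F` then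
`F'(y) = c₀·(1+y)^z·F(y)` at every point `‖y‖ < 1`. [cite: Koblitz1984, Ch. IV §1] -/
theorem hasValueAt_of_unit_binomPow {F F' : PowerSeries (PadicComplexInt p)} {z : ℤ_[p]}
    {c₀ : PadicComplexInt p} (h : F' = C c₀ * binomPow z * F) {y v : ℂ_[p]} (hy : ‖y‖ < 1)
    (hv : IntSeries.HasValueAt F y v) :
    IntSeries.HasValueAt F' y ((c₀ : ℂ_[p]) * onePlusPow z y * v) := by
  have hC : IntSeries.HasValueAt (C c₀) y (c₀ : ℂ_[p]) := by
    unfold IntSeries.HasValueAt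
    have : (fun k : ℕ ↦ ((coeff k (C c₀) : PadicComplexInt p) : ℂ_[p]) * y ^ k) =
        fun k ↦ if k = 0 then (c₀ : ℂ_[p]) else 0 := by
      funext k; rw [coeff_C]; split_ifs with hk <;> simp [hk]
    rw [this]; exact hasSum_ite_eq 0 _
  rw [h]
  exact (hC.mul hy (hasValueAt_binomPow z hy)).mul hy hv

/-- **The ratio at the nodes**: in the setting of `exists_unit_binomPow_of_values_proportional`, with
`F' = c₀·(1+T)^z·F`, one has `c·dᵗ = c₀·(uᵗ)^z` (`= c₀ · onePlusPow z (uᵗ − 1)`) at every node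
where `x_t ≠ 0`. [cite: Koblitz1984, Ch. IV §1] -/
theorem mul_pow_eq_of_unit_binomPow {F F' : PowerSeries (PadicComplexInt p)} {u c d : ℂ_[p]}
    {x x' : ℕ → ℂ_[p]} (hu : ‖u - 1‖ < 1) (hx : ∀ t : ℕ, IntSeries.HasValueAt F (u ^ t - 1) (x t))
    (hx' : ∀ t : ℕ, IntSeries.HasValueAt F' (u ^ t - 1) (x' t))
    (hrel : ∀ t : ℕ, x' t = c * d ^ t * x t) {z : ℤ_[p]} {c₀ : PadicComplexInt p}
    (h : F' = C c₀ * binomPow z * F) {t : ℕ} (ht : x t ≠ 0) :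
    c * d ^ t = (c₀ : ℂ_[p]) * onePlusPow z (u ^ t - 1) := by
  have hy : ‖u ^ t - 1‖ < 1 := by
    have hu1 : ‖u‖ = 1 := by
      have hh := IsUltrametricDist.norm_add_eq_max_of_norm_ne_norm (x := u - 1) (y := (1 : ℂ_[p]))
        (by rw [norm_one]; exact hu.ne)
      rw [sub_add_cancel, norm_one] at hh; rw [hh]; exact max_eq_right hu.le
    refine lt_of_le_of_lt ?_ hu
    rw [← geom_sum_mul, norm_mul]
    refine mul_le_of_le_one_left (norm_nonneg _) ?_
    refine IsUltrametricDist.norm_sum_le_of_forall_le_of_nonneg zero_le_one fun i _ ↦ ?_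
    rw [norm_pow, hu1, one_pow]
  have h1 := hasValueAt_of_unit_binomPow h hy (hx t)
  have h2 := (hx' t).unique h1
  rw [hrel t] at h2
  exact mul_right_cancel₀ ht (by rw [h2, mul_assoc])

/-! ### §4. (Appended) Base multiplicativity of `(1+x)^z` and the ratio itself: `d = u^z` -/

/-- **`((1+a)(1+b))^z = (1+a)^z·(1+b)^z`** for `‖a‖, ‖b‖ < 1`, `z ∈ ℤ_p` (both sides are continuous in
`z` and agree on the dense subset `ℕ ⊂ ℤ_p`). [cite: Koblitz1984, Ch. IV §1] -/
theorem onePlusPow_mul_base (z : ℤ_[p]) {a b : ℂ_[p]} (ha : ‖a‖ < 1) (hb : ‖b‖ < 1) :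
    onePlusPow z (a + b + a * b) = onePlusPow z a * onePlusPow z b := by
  have hab : ‖a + b + a * b‖ < 1 := by
    refine lt_of_le_of_lt (IsUltrametricDist.norm_add_le_max _ _) (max_lt ?_ ?_)
    · exact lt_of_le_of_lt (IsUltrametricDist.norm_add_le_max _ _) (max_lt ha hb)
    · rw [norm_mul]; exact mul_lt_one_of_nonneg_of_lt_one_left (norm_nonneg _) ha hb.le
  have h := PadicInt.denseRange_natCast.equalizer (continuous_onePlusPow hab)
    ((continuous_onePlusPow ha).mul (continuous_onePlusPow hb)) (funext fun m ↦ by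
      simp only [Function.comp_apply, Pi.mul_apply, onePlusPow_natCast]
      rw [← mul_pow]; ring)
  exact congrFun h z

/-- `(u^{t+1})^z = (uᵗ)^z · u^z` for a one-unit `u` (read through `onePlusPow` at `uᵗ − 1`).
[cite: Koblitz1984, Ch. IV §1] -/
theorem onePlusPow_pow_succ_sub_one (z : ℤ_[p]) {u : ℂ_[p]} (hu : ‖u - 1‖ < 1) (t : ℕ) :
    onePlusPow z (u ^ (t + 1) - 1) = onePlusPow z (u ^ t - 1) * onePlusPow z (u - 1) := by
  have hu1 : ‖u‖ = 1 := by
    have hh := IsUltrametricDist.norm_add_eq_max_of_norm_ne_norm (x := u - 1) (y := (1 : ℂ_[p]))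
      (by rw [norm_one]; exact hu.ne)
    rw [sub_add_cancel, norm_one] at hh; rw [hh]; exact max_eq_right hu.le
  have hut : ‖u ^ t - 1‖ < 1 := by
    refine lt_of_le_of_lt ?_ hu
    rw [← geom_sum_mul, norm_mul]
    refine mul_le_of_le_one_left (norm_nonneg _) ?_
    refine IsUltrametricDist.norm_sum_le_of_forall_le_of_nonneg zero_le_one fun i _ ↦ ?_
    rw [norm_pow, hu1, one_pow]
  rw [← onePlusPow_mul_base z hut hu]
  congr 1
  ring

/-- **THE RATIO IS `u^z`.** In the setting of `exists_unit_binomPow_of_values_proportional` (values of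
`F, F'` at the nodes `uᵗ − 1` proportional by `c·dᵗ`, one `x_{t₀} ≠ 0`, `F, F'` each with a unit
coefficient): with the unit twist `F' = C c₀ · binomPow z · F`, the ratio is `d = (1 + (u−1))^z = u^z`
(`onePlusPow z (u − 1)`) — p4 g0's «`D ∈ u^{ℤ_p}`». Proof: `F` has only finitely many zeros among the
nodes (identity principle), so two consecutive nodes carry non-zero values; compare
`c·dᵗ = c₀(uᵗ)^z` and `c·d^{t+1} = c₀(u^{t+1})^z = c₀(uᵗ)^z·u^z`.
[cite: Gouvea1993PadicNumbers, §5.9 (the binomial series `(1+x)^α`), Problem 194] -/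
theorem eq_onePlusPow_of_values_proportional {F F' : PowerSeries (PadicComplexInt p)}
    {u c d : ℂ_[p]} {x x' : ℕ → ℂ_[p]} (hu : ‖u - 1‖ < 1) (hroot : ∀ n : ℕ, 0 < n → u ^ n ≠ 1)
    (hc : c ≠ 0) (hd : d ≠ 0) (hx : ∀ t : ℕ, IntSeries.HasValueAt F (u ^ t - 1) (x t))
    (hx' : ∀ t : ℕ, IntSeries.HasValueAt F' (u ^ t - 1) (x' t))
    (hrel : ∀ t : ℕ, x' t = c * d ^ t * x t) {t₀ : ℕ} (h0 : x t₀ ≠ 0)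
    {z : ℤ_[p]} {c₀ : PadicComplexInt p} (h : F' = C c₀ * binomPow z * F) :
    d = onePlusPow z (u - 1) := by
  -- the zero nodes of `F` are finitely many
  have hu1 : ‖u‖ = 1 := by
    have hh := IsUltrametricDist.norm_add_eq_max_of_norm_ne_norm (x := u - 1) (y := (1 : ℂ_[p]))
      (by rw [norm_one]; exact hu.ne)
    rw [sub_add_cancel, norm_one] at hh; rw [hh]; exact max_eq_right hu.le
  have hu0 : u ≠ 0 := fun h0 ↦ by rw [h0, norm_zero] at hu1; exact zero_ne_one hu1
  have hϖ0 : u - 1 ≠ 0 := fun h1 ↦ hroot 1 one_pos (by rw [pow_one]; exact sub_eq_zero.1 h1)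
  have hF0 : F ≠ 0 := by
    intro hF
    apply h0
    have h1 := hx t₀
    rw [hF] at h1
    have h2 : IntSeries.HasValueAt (0 : PowerSeries (PadicComplexInt p)) (u ^ t₀ - 1) 0 := by
      unfold IntSeries.HasValueAt; simp
    exact h1.unique h2
  have hnode : ∀ t : ℕ, ‖u ^ t - 1‖ ≤ ‖u - 1‖ := fun t ↦ by
    rw [← geom_sum_mul, norm_mul]
    refine mul_le_of_le_one_left (norm_nonneg _) ?_
    refine IsUltrametricDist.norm_sum_le_of_forall_le_of_nonneg zero_le_one fun i _ ↦ ?_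
    rw [norm_pow, hu1, one_pow]
  have hinj : Function.Injective fun t : ℕ ↦ u ^ t - 1 := by
    have hkey : ∀ s n : ℕ, 0 < n → u ^ s ≠ u ^ (s + n) := by
      intro s n hn h'
      refine hroot n hn (mul_left_cancel₀ (pow_ne_zero s hu0) ?_)
      rw [mul_one, ← pow_add]; exact h'.symm
    intro s s' h'
    have h'' : u ^ s = u ^ s' := sub_left_injective h'
    by_contra hne
    rcases Nat.lt_or_gt_of_ne hne with hlt | hlt
    · have h2 := hkey s (s' - s) (Nat.sub_pos_of_lt hlt)
      rw [Nat.add_sub_cancel' hlt.le] at h2; exact h2 h''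
    · have h2 := hkey s' (s - s') (Nat.sub_pos_of_lt hlt)
      rw [Nat.add_sub_cancel' hlt.le] at h2; exact h2 h''.symm
  have hfin : {t : ℕ | x t = 0}.Finite := by
    by_contra hinf
    apply hF0
    refine eq_zero_of_infinite_zeros hϖ0 hu ?_
    have himage : ((fun t : ℕ ↦ u ^ t - 1) '' {t : ℕ | x t = 0}).Infinite :=
      (Set.not_finite.1 hinf).image hinj.injOn
    refine himage.mono ?_
    rintro y ⟨t, ht, rfl⟩
    refine ⟨hnode t, ?_⟩
    have := hx t
    rwa [show x t = 0 from ht] at this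
  -- two consecutive good nodes
  obtain ⟨N, hN⟩ := hfin.bddAbove
  have hgood : ∀ t, N < t → x t ≠ 0 := fun t ht hxt ↦ absurd (hN hxt) (not_le.2 ht)
  have h1 := mul_pow_eq_of_unit_binomPow hu hx hx' hrel h (hgood (N + 1) (by omega))
  have h2 := mul_pow_eq_of_unit_binomPow hu hx hx' hrel h (hgood (N + 2) (by omega))
  rw [show N + 2 = (N + 1) + 1 from rfl, onePlusPow_pow_succ_sub_one z hu (N + 1), ← mul_assoc, ← h1,
    pow_succ, ← mul_assoc] at h2
  exact mul_left_cancel₀ (mul_ne_zero hc (pow_ne_zero _ hd)) h2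

end Literature.NumberTheory.EllipticCurves.IntSeries

end
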